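import Mathlib
import Literature.NumberTheory.EllipticCurves.TunnellThetaCoefficients

/-!
# Hodge-locus census (cell `pub-hlocus`, ENGINE B, gen 53) — the `ℓ = 2` valuation case analysis
behind LEMMA E (the ramified, `d̃` odd sub-cell of the term-wise law), DEFINITION-FREE

certified instances and evidence bearing on the general Hodge conjecture; no claim.

Companion to ENGINE A's `HodgeLocusLVTermwiseLaw.lean` (gen 46), whose Part E proves the valuation floor
`v_ℓ(m)` even or `≥ 2k` from `a·m + x² = D`, `ℓ^{2k} ∣ D` for a prime `ℓ` NOT dividing the cofactor `a`,
and lists "the ramified-cell and `ℓ = 2` case analysis of Lemma 4" as not proved there.  This sheet does the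
`ℓ = 2`, `a = 4` case needed by ENGINE B's LEMMA E (cell record P-TCL-B-E, ABSHODGE LOG 2026-08-23,
DERIVATIONS_engineB.md §69.14): for `d₁ ≡ 0 (mod 4)` (2 ramified in `ℚ(√d₁)`) and `d₂ = 4^k·d̃` with `d̃`
ODD, the terms of [cite: LauterViray2015SingularModuli, Thm. 1.5] (arXiv:1206.6942, display (1.5)) are
indexed by even `x` with `m_x = (d₁d₂ − x²)/4`, i.e. `4·m_x + x² = 4^{k+1}·n` with `n = |d₁/4|·|d̃|`;
`n ≡ 3 (mod 4)` when `4 ∥ d₁` and `n = 2n'`, `n'` odd, when `8 ∣ d₁`.  Writing `m_x = 2^v·u` with `u` odd: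

* `shape_four`  (`4 ∥ d₁`): `v = 2k+1`, or `v` is even, `v ≤ 2k` and `u ≡ 3 (mod 4)`;
* `shape_eight` (`8 ∣ d₁`): `v = 2k+1`, or `v` is even, `v < 2k` and `u ≡ 7 (mod 8)`, or `v = 2k` and
  `u + 1 ≡ 2n' (mod 8)`.

Consequences recorded here: the CEILING `v ≤ 2k+1` in both cases (`ceiling_four`, `ceiling_eight`; this
alone gives `T_r = 0` for `r ≥ 2k+2` via A's `law_eq_zero_of_gt`, for `8 ∣ d₁` AND `4 ∥ d₁`), and off the
top class the valuation is EVEN with the stated unit congruence (`even_of_le_four`, `even_of_le_eight`).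
The unit congruences are exactly what makes the 2-adic Hilbert symbol `(d₁, −m_x)_2 = +1` on every class
with `v ≤ 2k` ([Serre, Cours d'arithmétique, III.1.2, Thm 1]: for 2-adic units `(u₁, u₂)_2 = (−1)^{ε(u₁)ε(u₂)}`,
`(2, u)_2 = (−1)^{ω(u)}`), while the Hilbert product formula forces `(d₁, −m_x)_2 = −1` on every term with
`ρ(m_x)·𝔄(m_x/2^v) ≠ 0` (LEMMA E (ii): the place left untested by `ρ` is `ℓ` itself) — so contributing
terms have `v = 2k+1` exactly and `T_r = T_1` for `r ≤ 2k+1`.  Those two Hilbert-symbol steps and the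
identification with the code objects are NOT formalised here (no Hilbert symbol API is used); this file is
elementary arithmetic of squares modulo 4 and 8, by induction on `k`.  Registered test of the whole lemma:
fresh universe U46-B, 777 triples, 630 669 terms, 0 exceptions (cell files out46/, kit j207073).
No `sorry`, no new axioms, no definitions.
-/

namespace Summit.HodgeConjecture.HodgeConjecture.HodgeLocus.Census.LVTermwiseLawTwoB

set_option linter.dupNamespace false

/-! ### Squares modulo 4 and 8 -/

/-- An even square is `≡ 0 (mod 4)`. -/
theorem sq_mod_four_of_even {x : ℕ} (hx : Even x) : x ^ 2 % 4 = 0 := by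
  obtain ⟨y, rfl⟩ := hx
  have : (y + y) ^ 2 = 4 * (y * y) := by ring
  rw [this]; simp

-- `sq_mod_eight_of_odd` (an odd square is `≡ 1 (mod 8)`) is the landed
-- `Literature.NumberTheory.EllipticCurves.ModularForms.sq_mod_eight_of_odd`, reused here.
open Literature.NumberTheory.EllipticCurves.ModularForms (sq_mod_eight_of_odd)

/-- An odd square is `≡ 1 (mod 4)`. -/
theorem sq_mod_four_of_odd {x : ℕ} (hx : Odd x) : x ^ 2 % 4 = 1 := by
  have := sq_mod_eight_of_odd hx; omega

/-- No square is `≡ 2 (mod 4)`. -/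
theorem sq_mod_four_ne_two (x : ℕ) : x ^ 2 % 4 ≠ 2 := by
  rcases Nat.even_or_odd x with h | h
  · rw [sq_mod_four_of_even h]; decide
  · rw [sq_mod_four_of_odd h]; decide

/-- No square is `≡ 3 (mod 4)`. -/
theorem sq_mod_four_ne_three (x : ℕ) : x ^ 2 % 4 ≠ 3 := by
  rcases Nat.even_or_odd x with h | h
  · rw [sq_mod_four_of_even h]; decide
  · rw [sq_mod_four_of_odd h]; decide

/-- If `4 ∣ x²` then `x` is even. -/
theorem even_of_four_dvd_sq {x : ℕ} (h : x ^ 2 % 4 = 0) : Even x := by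
  rcases Nat.even_or_odd x with hx | hx
  · exact hx
  · rw [sq_mod_four_of_odd hx] at h; exact absurd h (by decide)

/-! ### The `4 ∥ d₁` case: `4·(2^v u) + x² = 4^{k+1}·n`, `n ≡ 3 (mod 4)`, `u` odd -/

/-- LEMMA E (i)+(iii-shape), case `4 ∥ d₁`.  From `4·(2^v·u) + x² = 4^{k+1}·n` with `u` odd and
`n ≡ 3 (mod 4)`: either `v = 2k+1`, or `v` is even, `v ≤ 2k` and `u ≡ 3 (mod 4)`. -/
theorem shape_four (k : ℕ) : ∀ (n x v u : ℕ), n % 4 = 3 → Odd u →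
    4 * (2 ^ v * u) + x ^ 2 = 4 ^ (k + 1) * n →
    v = 2 * k + 1 ∨ (Even v ∧ v ≤ 2 * k ∧ u % 4 = 3) := by
  induction k with
  | zero =>
    intro n x v u hn hu h
    simp only [zero_add, pow_one, Nat.mul_zero] at h ⊢
    -- x is even
    have hx4 : x ^ 2 % 4 = 0 := by omega
    obtain ⟨y, rfl⟩ := even_of_four_dvd_sq hx4
    have hy : (y + y) ^ 2 = 4 * y ^ 2 := by ring
    rw [hy] at h
    have h' : 2 ^ v * u + y ^ 2 = n := by omega
    rcases v with _ | v
    · -- v = 0: u + y² = n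
      right
      simp only [pow_zero, one_mul] at h'
      refine ⟨⟨0, rfl⟩, le_refl _, ?_⟩
      rcases Nat.even_or_odd y with hy2 | hy2
      · have := sq_mod_four_of_even hy2; omega
      · -- u = n - y² with y odd: u even, contradiction with u odd
        have h1 := sq_mod_four_of_odd hy2
        have : u % 2 = 0 := by omega
        exact absurd this (Nat.odd_iff.mp hu ▸ by decide)
    · rcases v with _ | v
      · left; rfl
      · -- v ≥ 2: y² ≡ n ≡ 3 (mod 4), impossible
        exfalso
        have h4 : 2 ^ (v + 2) * u = 4 * (2 ^ v * u) := by ring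
        rw [h4] at h'
        have : y ^ 2 % 4 = 3 := by omega
        exact sq_mod_four_ne_three y this
  | succ k ih =>
    intro n x v u hn hu h
    rcases v with _ | v
    · -- v = 0: 4u + x² = 4^{k+2} n, so x = 2y, u + y² = 4^{k+1} n ≡ 0 (mod 4)
      right
      simp only [pow_zero, one_mul] at h
      have hx4 : x ^ 2 % 4 = 0 := by
        have : (4 ^ (k + 1 + 1) * n) % 4 = 0 := by
          rw [pow_succ, Nat.mul_assoc, Nat.mul_comm 4, ← Nat.mul_assoc]; simp
        omega
      obtain ⟨y, rfl⟩ := even_of_four_dvd_sq hx4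
      have hy : (y + y) ^ 2 = 4 * y ^ 2 := by ring
      rw [hy] at h
      have h' : u + y ^ 2 = 4 ^ (k + 1) * n := by
        have : 4 ^ (k + 1 + 1) * n = 4 * (4 ^ (k + 1) * n) := by ring
        omega
      have hmod : (4 ^ (k + 1) * n) % 4 = 0 := by
        rw [pow_succ, Nat.mul_assoc, Nat.mul_comm 4, ← Nat.mul_assoc]; simp
      refine ⟨⟨0, rfl⟩, Nat.zero_le _, ?_⟩
      rcases Nat.even_or_odd y with hy2 | hy2
      · have h1 := sq_mod_four_of_even hy2
        have : u % 2 = 0 := by omega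
        exact absurd this (Nat.odd_iff.mp hu ▸ by decide)
      · have h1 := sq_mod_four_of_odd hy2; omega
    · rcases v with _ | v
      · -- v = 1: 8u + x² = 4^{k+2} n, x = 2y, 2u + y² ≡ 0 (mod 4): y² ≡ 2 (mod 4), impossible
        exfalso
        simp only [zero_add, pow_one] at h
        have hx4 : x ^ 2 % 4 = 0 := by
          have : (4 ^ (k + 1 + 1) * n) % 4 = 0 := by
            rw [pow_succ, Nat.mul_assoc, Nat.mul_comm 4, ← Nat.mul_assoc]; simp
          omega
        obtain ⟨y, rfl⟩ := even_of_four_dvd_sq hx4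
        have hy : (y + y) ^ 2 = 4 * y ^ 2 := by ring
        rw [hy] at h
        have h' : 2 * u + y ^ 2 = 4 ^ (k + 1) * n := by
          have : 4 ^ (k + 1 + 1) * n = 4 * (4 ^ (k + 1) * n) := by ring
          omega
        have hmod : (4 ^ (k + 1) * n) % 4 = 0 := by
          rw [pow_succ, Nat.mul_assoc, Nat.mul_comm 4, ← Nat.mul_assoc]; simp
        have hu2 : u % 2 = 1 := Nat.odd_iff.mp hu
        have : y ^ 2 % 4 = 2 := by omega
        exact sq_mod_four_ne_two y this
      · -- v ≥ 2: divide by 4 and use the induction hypothesis with k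
        have hx4 : x ^ 2 % 4 = 0 := by
          have h1 : (4 ^ (k + 1 + 1) * n) % 4 = 0 := by
            rw [pow_succ, Nat.mul_assoc, Nat.mul_comm 4, ← Nat.mul_assoc]; simp
          have h2 : (4 * (2 ^ (v + 1 + 1) * u)) % 4 = 0 := by simp
          omega
        obtain ⟨y, rfl⟩ := even_of_four_dvd_sq hx4
        have hy : (y + y) ^ 2 = 4 * y ^ 2 := by ring
        rw [hy] at h
        have h' : 4 * (2 ^ v * u) + y ^ 2 = 4 ^ (k + 1) * n := by
          have e1 : 4 ^ (k + 1 + 1) * n = 4 * (4 ^ (k + 1) * n) := by ring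
          have e2 : 4 * (2 ^ (v + 1 + 1) * u) = 4 * (4 * (2 ^ v * u)) := by ring
          omega
        rcases ih n y v u hn hu h' with h1 | ⟨h2, h3, h4⟩
        · left; omega
        · right
          refine ⟨?_, by omega, h4⟩
          obtain ⟨t, ht⟩ := h2
          exact ⟨t + 1, by omega⟩

/-- CEILING, case `4 ∥ d₁`: `v ≤ 2k+1` (LEMMA E (i)); with ENGINE A's `law_eq_zero_of_gt` this is
`T_r = 0` for every `r ≥ 2k+2` on these rows — the 147-row sub-cell left open by G45-TCL (P4)(d). -/
theorem ceiling_four {k n x v u : ℕ} (hn : n % 4 = 3) (hu : Odd u)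
    (h : 4 * (2 ^ v * u) + x ^ 2 = 4 ^ (k + 1) * n) : v ≤ 2 * k + 1 := by
  rcases shape_four k n x v u hn hu h with h1 | ⟨_, h3, _⟩ <;> omega

/-- Off the top class the valuation is even and the unit is `≡ 3 (mod 4)` (case `4 ∥ d₁`): the input of
the Hilbert-symbol evaluation `(d₁, −m_x)_2 = +1` in LEMMA E (iii). -/
theorem even_of_le_four {k n x v u : ℕ} (hn : n % 4 = 3) (hu : Odd u)
    (h : 4 * (2 ^ v * u) + x ^ 2 = 4 ^ (k + 1) * n) (hv : v ≤ 2 * k) : Even v ∧ u % 4 = 3 := by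
  rcases shape_four k n x v u hn hu h with h1 | ⟨h2, _, h4⟩
  · omega
  · exact ⟨h2, h4⟩

/-- In particular an ODD valuation is the top one (case `4 ∥ d₁`). -/
theorem eq_top_of_odd_four {k n x v u : ℕ} (hn : n % 4 = 3) (hu : Odd u)
    (h : 4 * (2 ^ v * u) + x ^ 2 = 4 ^ (k + 1) * n) (hv : Odd v) : v = 2 * k + 1 := by
  rcases shape_four k n x v u hn hu h with h1 | ⟨h2, _, _⟩
  · exact h1
  · exact absurd h2 (Nat.not_even_iff_odd.mpr hv)

/-! ### The `8 ∣ d₁` case: `4·(2^v u) + x² = 4^{k+1}·(2 n')`, `n'` odd, `u` odd -/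

/-- LEMMA E (i)+(iii-shape), case `8 ∣ d₁`.  From `4·(2^v·u) + x² = 4^{k+1}·(2n')` with `u`, `n'` odd:
either `v = 2k+1`, or `v` is even, `v < 2k` and `u ≡ 7 (mod 8)`, or `v = 2k` and `u + 1 ≡ 2n' (mod 8)`. -/
theorem shape_eight (k : ℕ) : ∀ (n' x v u : ℕ), Odd n' → Odd u →
    4 * (2 ^ v * u) + x ^ 2 = 4 ^ (k + 1) * (2 * n') →
    v = 2 * k + 1 ∨ (Even v ∧ v < 2 * k ∧ u % 8 = 7) ∨ (v = 2 * k ∧ (u + 1) % 8 = (2 * n') % 8) := by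
  induction k with
  | zero =>
    intro n' x v u hn hu h
    simp only [zero_add, pow_one, Nat.mul_zero] at h ⊢
    have hx4 : x ^ 2 % 4 = 0 := by omega
    obtain ⟨y, rfl⟩ := even_of_four_dvd_sq hx4
    have hy : (y + y) ^ 2 = 4 * y ^ 2 := by ring
    rw [hy] at h
    have h' : 2 ^ v * u + y ^ 2 = 2 * n' := by omega
    have hn2 : n' % 2 = 1 := Nat.odd_iff.mp hn
    have hu2 : u % 2 = 1 := Nat.odd_iff.mp hu
    rcases v with _ | v
    · -- v = 0: u + y² = 2n'; y odd (parity), so u + 1 ≡ 2n' (mod 8)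
      right; right
      simp only [pow_zero, one_mul] at h'
      refine ⟨rfl, ?_⟩
      rcases Nat.even_or_odd y with hy2 | hy2
      · have h1 := sq_mod_four_of_even hy2
        obtain ⟨t, ht⟩ := hy2
        have : (t + t) ^ 2 = 4 * t ^ 2 := by ring
        omega
      · have h1 := sq_mod_eight_of_odd hy2; omega
    · rcases v with _ | v
      · left; rfl
      · exfalso
        have h4 : 2 ^ (v + 2) * u = 4 * (2 ^ v * u) := by ring
        rw [h4] at h'
        have : y ^ 2 % 4 = 2 := by omega
        exact sq_mod_four_ne_two y this
  | succ k ih =>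
    intro n' x v u hn hu h
    have hn2 : n' % 2 = 1 := Nat.odd_iff.mp hn
    have hu2 : u % 2 = 1 := Nat.odd_iff.mp hu
    have hmod8 : (4 ^ (k + 1) * (2 * n')) % 8 = 0 := by
      have : 4 ^ (k + 1) * (2 * n') = 8 * (4 ^ k * n') := by ring
      omega
    rcases v with _ | v
    · -- v = 0: 4u + x² = 4^{k+2}(2n'), x = 2y, u + y² = 4^{k+1}(2n') ≡ 0 (mod 8): y odd, u ≡ 7 (mod 8)
      right; left
      simp only [pow_zero, one_mul] at h
      have hx4 : x ^ 2 % 4 = 0 := by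
        have : (4 ^ (k + 1 + 1) * (2 * n')) % 4 = 0 := by
          rw [pow_succ, Nat.mul_assoc, Nat.mul_comm 4, ← Nat.mul_assoc]; simp
        omega
      obtain ⟨y, rfl⟩ := even_of_four_dvd_sq hx4
      have hy : (y + y) ^ 2 = 4 * y ^ 2 := by ring
      rw [hy] at h
      have h' : u + y ^ 2 = 4 ^ (k + 1) * (2 * n') := by
        have : 4 ^ (k + 1 + 1) * (2 * n') = 4 * (4 ^ (k + 1) * (2 * n')) := by ring
        omega
      refine ⟨⟨0, rfl⟩, by omega, ?_⟩
      rcases Nat.even_or_odd y with hy2 | hy2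
      · have h1 := sq_mod_four_of_even hy2; omega
      · have h1 := sq_mod_eight_of_odd hy2; omega
    · rcases v with _ | v
      · -- v = 1: 8u + x² = 4^{k+2}(2n'), x = 2y, 2u + y² ≡ 0 (mod 8): y² ≡ 2 (mod 4), impossible
        exfalso
        simp only [zero_add, pow_one] at h
        have hx4 : x ^ 2 % 4 = 0 := by
          have : (4 ^ (k + 1 + 1) * (2 * n')) % 4 = 0 := by
            rw [pow_succ, Nat.mul_assoc, Nat.mul_comm 4, ← Nat.mul_assoc]; simp
          omega
        obtain ⟨y, rfl⟩ := even_of_four_dvd_sq hx4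
        have hy : (y + y) ^ 2 = 4 * y ^ 2 := by ring
        rw [hy] at h
        have h' : 2 * u + y ^ 2 = 4 ^ (k + 1) * (2 * n') := by
          have : 4 ^ (k + 1 + 1) * (2 * n') = 4 * (4 ^ (k + 1) * (2 * n')) := by ring
          omega
        have : y ^ 2 % 4 = 2 := by omega
        exact sq_mod_four_ne_two y this
      · -- v ≥ 2: divide by 4, induction hypothesis with k
        have hx4 : x ^ 2 % 4 = 0 := by
          have h1 : (4 ^ (k + 1 + 1) * (2 * n')) % 4 = 0 := by
            rw [pow_succ, Nat.mul_assoc, Nat.mul_comm 4, ← Nat.mul_assoc]; simp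
          have h2 : (4 * (2 ^ (v + 1 + 1) * u)) % 4 = 0 := by simp
          omega
        obtain ⟨y, rfl⟩ := even_of_four_dvd_sq hx4
        have hy : (y + y) ^ 2 = 4 * y ^ 2 := by ring
        rw [hy] at h
        have h' : 4 * (2 ^ v * u) + y ^ 2 = 4 ^ (k + 1) * (2 * n') := by
          have e1 : 4 ^ (k + 1 + 1) * (2 * n') = 4 * (4 ^ (k + 1) * (2 * n')) := by ring
          have e2 : 4 * (2 ^ (v + 1 + 1) * u) = 4 * (4 * (2 ^ v * u)) := by ring
          omega
        rcases ih n' y v u hn hu h' with h1 | ⟨h2, h3, h4⟩ | ⟨h5, h6⟩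
        · left; omega
        · right; left
          refine ⟨?_, by omega, h4⟩
          obtain ⟨t, ht⟩ := h2
          exact ⟨t + 1, by omega⟩
        · right; right
          exact ⟨by omega, h6⟩

/-- CEILING, case `8 ∣ d₁`: `v ≤ 2k+1` (LEMMA E (i); = G45-TCL (P4)(d) `T_{2k+2} = T_{2k+3} = 0`). -/
theorem ceiling_eight {k n' x v u : ℕ} (hn : Odd n') (hu : Odd u)
    (h : 4 * (2 ^ v * u) + x ^ 2 = 4 ^ (k + 1) * (2 * n')) : v ≤ 2 * k + 1 := by
  rcases shape_eight k n' x v u hn hu h with h1 | ⟨_, h3, _⟩ | ⟨h5, _⟩ <;> omega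

/-- Off the top class the valuation is even (case `8 ∣ d₁`), with unit `≡ 7 (mod 8)` below `2k` and
`u + 1 ≡ 2n' (mod 8)` at `v = 2k`: the inputs of `(d₁, −m_x)_2 = +1` in LEMMA E (iii). -/
theorem even_of_le_eight {k n' x v u : ℕ} (hn : Odd n') (hu : Odd u)
    (h : 4 * (2 ^ v * u) + x ^ 2 = 4 ^ (k + 1) * (2 * n')) (hv : v ≤ 2 * k) :
    Even v ∧ ((v < 2 * k ∧ u % 8 = 7) ∨ (v = 2 * k ∧ (u + 1) % 8 = (2 * n') % 8)) := by
  rcases shape_eight k n' x v u hn hu h with h1 | ⟨h2, h3, h4⟩ | ⟨h5, h6⟩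
  · omega
  · exact ⟨h2, Or.inl ⟨h3, h4⟩⟩
  · exact ⟨⟨k, by omega⟩, Or.inr ⟨h5, h6⟩⟩

/-- In particular an ODD valuation is the top one (case `8 ∣ d₁`). -/
theorem eq_top_of_odd_eight {k n' x v u : ℕ} (hn : Odd n') (hu : Odd u)
    (h : 4 * (2 ^ v * u) + x ^ 2 = 4 ^ (k + 1) * (2 * n')) (hv : Odd v) : v = 2 * k + 1 := by
  rcases shape_eight k n' x v u hn hu h with h1 | ⟨h2, _, _⟩ | ⟨h5, _⟩
  · exact h1
  · exact absurd h2 (Nat.not_even_iff_odd.mpr hv)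
  · exfalso; rw [h5] at hv; exact (Nat.not_even_iff_odd.mpr hv) ⟨k, by ring⟩

/-! ### Instances from the registered universes (sanity anchors; `decide`-free, by the theorems above) -/

/-- U45 row `(d₁, d₂, ℓ) = (−632, −48, 2)`: `d₁ = −8·79`, `d̃ = −3`, `k = 2`, `n = 2·(79·3)`; the term
`x = 0` has `m_0 = 632·48/4 = 7584 = 2^5·237`, valuation `5 = 2k+1` (top class, as every `x = 0` term in
the `8 ∣ d₁` case). -/
example : 4 * (2 ^ 5 * 237) + 0 ^ 2 = 4 ^ (2 + 1) * (2 * 237) := by norm_num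

/-- U46-B row `(−996, −44, 2)`: `d₁ = −4·249`, `249 ≡ 1`, `d̃ = −11`, `n = 249·11 = 2739 ≡ 3 (mod 4)`,
`k = 1`; the term `x = 2` has `m = (996·44 − 4)/4 = 10955`, odd (`v = 0`, even, `≤ 2k`) with
`10955 ≡ 3 (mod 4)` as `shape_four` predicts; the term `x = 4` (`y = x/2 = 2^k`) has
`m = 10956 − 4 = 10952 = 2^3·1369`, valuation `3 = 2k+1` (top class). -/
example : 4 * (2 ^ 0 * 10955) + 2 ^ 2 = 4 ^ (1 + 1) * 2739 ∧ 10955 % 4 = 3 ∧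
    4 * (2 ^ 3 * 1369) + 4 ^ 2 = 4 ^ (1 + 1) * 2739 := by norm_num

end Summit.HodgeConjecture.HodgeConjecture.HodgeLocus.Census.LVTermwiseLawTwoB
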